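import Mathlib
import HarnessLib
import Summits.HubbardSuperconductivity.HubbardSuperconductivity.Theorems.KLProgrammeC4aPPKernelShiftFlatnessLine
import Summits.HubbardSuperconductivity.HubbardSuperconductivity.Theorems.KLProgrammeC4aAntidiagonalFlatnessTransfer

/-!
# Route `KLProgramme` — crux C4a, S3 brick (B4) «(B4)-UMK1», «(M1)-TRUE-KERNEL» adaptation (Ω), part 4: THE FLATNESS NUMBER OF THE TRANSFER KERNEL
# `𝒦_Ω(e,u) = N_Ω(e,u)·κ(e/(e+u))/(e+u−iΩ)` at every nonzero bosonic transfer frequency `Ω = 2mπ/β`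

Cell `gate-hubbard-kl`, seat hubbard-kl-k3c3-p1 (g15; row «δμ-flow with klAngularMean constant piece»).  Conclusion of the Ω-series `…C4aPPKernelShiftNumerator`,
`…ShiftNumeratorFar`, `…ShiftFlatnessLine` (stub (C) of stmt-HubbardSuperconductivity-20437; note `M1-TRUE-KERNEL.md` §7): the instance of the abstract transfer lemma
`…C4aAntidiagonalFlatnessTransfer.norm_integral_antidiagonal_flatness_transfer_le` for the model's shifted numerator.
* §1 **`shiftKernel_antidiagonal_flatness_le`** (long lines `Λ < (1−t₁)D`):
  `‖∫_0^D ∂ᵤ𝒦_Ω(e,D−e) de‖ ≤ κ₀((6B₁+7/2)Λ + 2/β + Λ/(1−t₁))/D² + 4κ₀|Ω|/(Λ·|D−iΩ|)` — the `Ω = 0`-type flatness number (same weighted-L¹ sizes as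
  `…TrueFlatness.trueKernel_antidiagonal_flatness_le`, loop-end constant improved to `6B₁+5/2` by the uniform gradient bound) PLUS the transfer term, which is
  `≤ 4κ₀/Λ · min(1, |Ω|/D)`: `1/D`-class with coefficient `4κ₀|Ω|/Λ` (small for the low bosonic frequencies `|Ω| ≲ Λ`), bounded by `4κ₀/Λ` uniformly;
* §2 **`shiftKernel_antidiagonal_flatness_short_le`** (every `D > 0`): `≤ ((6B₁+13/2)κ₀ + 4κ₁)/Λ`;
* §3 **`shiftKernel_antidiagonal_flatness_shape`** (every `D > 0`): `≤ A₁^Ω·Λ/max(D,Λ)² + 4κ₀|Ω|/(Λ|D−iΩ|)`,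
  `A₁^Ω = ((6B₁+13/2)κ₀+4κ₁)·4/(1−t₁)² + κ₀(6B₁+7/2+2/(βΛ)+1/(1−t₁))`.
Honest reading (memo §7): at `Ω ≠ 0` the flatness number is NOT `O(Λ/D²)` — the transfer resolvent contributes a genuine `|Ω|/(D|D−iΩ|)`-type piece; the bound's
coefficient `4κ₀‖N_Ω‖`-size `4|D−iΩ|/Λ` is crude for `|Ω| ≫ Λ` (true size logarithmic), sharp enough for `|Ω| ≲ Λ`.
Pure real/complex analysis; nothing asserts (C), K3 or superconductivity.
References: BGM 2006 §2.4 [cite: BenfattoGiulianiMastropietro2006]; FST 1998 §3 [cite: FeldmanSalmhoferTrubowitz1998].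
-/

noncomputable section

namespace Summit.HubbardSuperconductivity.HubbardSuperconductivity.Theorems.C4a

set_option linter.dupNamespace false -- summit = problem name (single-conjunct summit), D-0017

open Real Filter Set Complex MeasureTheory intervalIntegral
open scoped Topology Interval
open Literature.MathematicalPhysics.QuantumLattice Literature.Analysis.SpecialFunctions

/-! ## §1 Long lines -/

/-- On the line `e + u = D` the transfer denominator is the constant `D − iΩ`. [folklore] -/
theorem transferDen_line (β : ℝ) (m : ℤ) (D e : ℝ) : (e : ℂ) + ((D - e : ℝ) : ℂ) - I * (ppBose β m : ℝ) = (D : ℂ) - I * (ppBose β m : ℝ) := by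
  push_cast; ring

/-- `‖D − iΩ‖² = D² + Ω²` and `D ≤ ‖D − iΩ‖`. [folklore] -/
theorem norm_transferDen_sq (D Ω : ℝ) : ‖(D : ℂ) - I * Ω‖ ^ 2 = D ^ 2 + Ω ^ 2 ∧ |D| ≤ ‖(D : ℂ) - I * Ω‖ := by
  refine ⟨?_, ?_⟩
  · rw [Complex.sq_norm, Complex.normSq_apply]; simp; ring
  · have h := Complex.abs_re_le_norm ((D : ℂ) - I * Ω); simpa using h

/-- **THE FLATNESS NUMBER OF THE TRANSFER KERNEL ON A LONG LINE.**  `0 < β`, `0 < Λ`, `|χ′| ≤ B₁`, `m ≠ 0`, `Ω = 2mπ/β`; split `κ ∈ C¹`, `|κ| ≤ κ₀` on `[0,1]`,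
`κ = 0` on `[t₁,∞)`, `0 ≤ t₁ < 1`; line `e + u = D` with `Λ < (1−t₁)D`.  THEN
`‖∫_0^D ∂ᵤ𝒦_Ω(e, D−e) de‖ ≤ κ₀((6B₁+7/2)Λ + 2/β + Λ/(1−t₁))/D² + 4κ₀|Ω|/(Λ‖D−iΩ‖)`.
[cite: BenfattoGiulianiMastropietro2006, §2.4 (2.36)] -/
theorem shiftKernel_antidiagonal_flatness_le {β Λ : ℝ} (hβ : 0 < β) (hΛ : 0 < Λ) {B₁ : ℝ} (hB₁ : ∀ x, |deriv salmhoferCutoff x| ≤ B₁) {m : ℤ} (hm : m ≠ 0)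
    {κ κ' : ℝ → ℝ} {κ₀ t₁ D : ℝ} (hκ : ∀ t, HasDerivAt κ (κ' t) t) (hκ'c : Continuous κ') (hκb : ∀ t ∈ Icc 0 1, |κ t| ≤ κ₀) (hκ₀ : 0 ≤ κ₀)
    (ht₀ : 0 ≤ t₁) (ht₁ : t₁ < 1) (hκs : ∀ t, t₁ ≤ t → κ t = 0) (hD : Λ < (1 - t₁) * D) :
    ‖∫ e in (0 : ℝ)..D, (((D : ℂ) - I * (ppBose β m : ℝ))⁻¹ * (ppShiftNumeratorDu β Λ m e (D - e) * κ (e / D)) -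
        ppShiftNumerator β Λ m e (D - e) *
          (((D : ℂ) - I * (ppBose β m : ℝ))⁻¹ * (κ' (e / D) * (e / D)) / D + ((D : ℂ) - I * (ppBose β m : ℝ))⁻¹ ^ 2 * κ (e / D)))‖ ≤
      κ₀ * ((6 * B₁ + 7 / 2) * Λ + 2 / β + Λ / (1 - t₁)) / D ^ 2 + 4 * κ₀ * |ppBose β m| / (Λ * ‖(D : ℂ) - I * (ppBose β m : ℝ)‖) := by
  have hB0 := salmhoferB₁_nonneg hB₁
  have h1t : 0 < 1 - t₁ := by linarith
  have hDpos : 0 < D := by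
    by_contra h
    have : (1 - t₁) * D ≤ 0 := mul_nonpos_of_nonneg_of_nonpos h1t.le (not_lt.1 h)
    linarith
  have hΛD : Λ < D := hD.trans_le (by nlinarith)
  set Ω : ℝ := ppBose β m with hΩ
  set w : ℂ := (D : ℂ) - I * Ω with hw
  obtain ⟨hw2, hwD⟩ := norm_transferDen_sq D Ω
  rw [abs_of_pos hDpos] at hwD
  have hwpos : 0 < ‖w‖ := hDpos.trans_le hwD
  set u₀ : ℝ := (1 - t₁) * D with hu₀
  have hu₀Λ : Λ < u₀ := hD
  -- the far region on the split's support: `κ(e/D) ≠ 0 ⟹ u₀ < D − e`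
  have hfar : ∀ e ∈ Icc (0 : ℝ) D, κ (e / D) ≠ 0 → u₀ < D - e := fun e he hκe => by
    have hlt : e / D < t₁ := by
      by_contra h
      exact hκe (hκs _ (not_lt.1 h))
    rw [div_lt_iff₀ hDpos] at hlt
    rw [hu₀]; nlinarith
  have hκe : ∀ e ∈ Icc (0 : ℝ) D, |κ (e / D)| ≤ κ₀ := fun e he =>
    hκb (e / D) ⟨div_nonneg he.1 hDpos.le, (div_le_one hDpos).2 he.2⟩
  -- the line functions
  set n : ℝ → ℂ := fun e => ppShiftNumerator β Λ m e (D - e) with hn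
  set n₁ : ℝ → ℂ := fun e => ppShiftNumeratorDu β Λ m (D - e) e with hn₁
  set n₂ : ℝ → ℂ := fun e => ppShiftNumeratorDu β Λ m e (D - e) with hn₂
  have hnd : ∀ e ∈ Icc (0 : ℝ) D, HasDerivAt n (n₁ e - n₂ e) e := fun e _ => hasDerivAt_ppShiftNumerator_line hβ hΛ hB₁ hm D e
  have hn₁c : Continuous n₁ := continuous_shiftNumeratorDe_line hβ hΛ hB₁ m D
  have hn₂c : Continuous n₂ := continuous_shiftNumeratorDu_line hβ hΛ hB₁ m D
  have hnc : Continuous n := continuous_shiftNumerator_line hβ hΛ hm D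
  have hbd : n D * (κ 1 : ℂ) = 0 := by rw [hκs 1 ht₁.le]; simp
  have hκcont : Continuous κ := continuous_iff_continuousAt.2 fun t => (hκ t).continuousAt
  have hκDc : Continuous fun e : ℝ => κ (e / D) := hκcont.comp (continuous_id.div_const D)
  -- M₁: the loop-level derivative
  have hS := fun e => norm_ppShiftNumeratorDu_le_unif hβ hΛ hB₁ m (D - e) e
  have hp₁lo : ∀ e ∈ Ι (0 : ℝ) Λ, ‖‖n₁ e‖ * |κ (e / D)| * e‖ ≤ κ₀ * (6 * B₁ + 5 / 2) := fun e he => by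
    rw [uIoc_of_le hΛ.le] at he
    have heD : e ∈ Icc (0 : ℝ) D := ⟨he.1.le, he.2.trans hΛD.le⟩
    rw [Real.norm_eq_abs, abs_mul, abs_mul, abs_norm, abs_abs, abs_of_nonneg he.1.le]
    calc ‖n₁ e‖ * |κ (e / D)| * e ≤ (6 * B₁ + 5 / 2) / Λ * κ₀ * Λ :=
          mul_le_mul (mul_le_mul (hS e) (hκe e heD) (abs_nonneg _) (by positivity)) he.2 he.1.le (by positivity)
      _ = κ₀ * (6 * B₁ + 5 / 2) := by field_simp
  have hp₁hi : ∀ e ∈ Ι Λ D, ‖n₁ e‖ * |κ (e / D)| * e ≤ κ₀ * (β * e * Real.exp (-(β * e))) := fun e he => by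
    rw [uIoc_of_le hΛD.le] at he
    have heD : e ∈ Icc (0 : ℝ) D := ⟨hΛ.le.trans he.1.le, he.2⟩
    have he0 : 0 ≤ e := hΛ.le.trans he.1.le
    by_cases hκ0 : κ (e / D) = 0
    · rw [hκ0, abs_zero, mul_zero, zero_mul]; positivity
    · have hu : Λ < D - e := hu₀Λ.trans (hfar e heD hκ0)
      have hex : n₁ e = ((β / 4 * sech (β * e / 2) ^ 2 : ℝ) : ℂ) := ppShiftNumeratorDu_of_far_of_far hβ hΛ he.1 hu m
      have hsech : sech (β * e / 2) ^ 2 ≤ 4 * Real.exp (-(β * e)) := sech_half_sq_le_four_exp_neg (by positivity)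
      rw [hex, Complex.norm_real, Real.norm_eq_abs, abs_of_nonneg (by positivity : (0 : ℝ) ≤ β / 4 * sech (β * e / 2) ^ 2)]
      calc β / 4 * sech (β * e / 2) ^ 2 * |κ (e / D)| * e ≤ β / 4 * (4 * Real.exp (-(β * e))) * κ₀ * e := by
            gcongr
            · exact hκe e heD
        _ = κ₀ * (β * e * Real.exp (-(β * e))) := by ring
  have hi₁ : ∀ a b : ℝ, IntervalIntegrable (fun e => ‖n₁ e‖ * |κ (e / D)| * e) volume a b := fun a b =>
    ((hn₁c.norm.mul hκDc.abs).mul continuous_id).intervalIntegrable _ _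
  have hM₁ : ∫ e in (0 : ℝ)..D, ‖n₁ e‖ * |κ (e / D)| * e ≤ κ₀ * ((6 * B₁ + 5 / 2) * Λ + Λ + 1 / β) := by
    rw [← intervalIntegral.integral_add_adjacent_intervals (hi₁ 0 Λ) (hi₁ Λ D)]
    have hlo := intervalIntegral.norm_integral_le_of_norm_le_const hp₁lo
    rw [Real.norm_eq_abs, sub_zero, abs_of_pos hΛ] at hlo
    have hlo' : ∫ e in (0 : ℝ)..Λ, ‖n₁ e‖ * |κ (e / D)| * e ≤ κ₀ * (6 * B₁ + 5 / 2) * Λ := (le_abs_self _).trans hlo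
    have hhi : ∫ e in Λ..D, ‖n₁ e‖ * |κ (e / D)| * e ≤ ∫ e in Λ..D, κ₀ * (β * e * Real.exp (-(β * e))) :=
      intervalIntegral.integral_mono_on_of_le_Ioo hΛD.le (hi₁ Λ D)
        ((continuous_const.mul ((continuous_const.mul continuous_id).mul (Real.continuous_exp.comp (continuous_const.mul continuous_id).neg))).intervalIntegrable _ _)
        fun e he => hp₁hi e (by rw [uIoc_of_le hΛD.le]; exact ⟨he.1, he.2.le⟩)
    have hexp := integral_mul_exp_neg_mul_le hβ hΛ.le hΛD.le
    rw [intervalIntegral.integral_const_mul] at hhi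
    have hexp' : (Λ + 1 / β) * Real.exp (-(β * Λ)) ≤ Λ + 1 / β := by
      have h1 : Real.exp (-(β * Λ)) ≤ 1 := Real.exp_le_one_iff.2 (by nlinarith)
      have h2 : 0 ≤ Λ + 1 / β := by positivity
      nlinarith
    nlinarith [hlo', hhi, hexp, hexp', hκ₀]
  -- M₂: the partner-level derivative
  have hp₂ : ∀ e ∈ Icc (0 : ℝ) D, ‖n₂ e‖ * |κ (e / D)| * (D - e) ≤ κ₀ * (β * (D - e) * Real.exp (-(β * (D - e))) + Λ / u₀) := fun e he => by
    have hue : 0 ≤ D - e := by linarith [he.2]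
    by_cases hκ0 : κ (e / D) = 0
    · rw [hκ0, abs_zero, mul_zero, zero_mul]; positivity
    · have hu0 : u₀ < D - e := hfar e he hκ0
      have hu : Λ < D - e := hu₀Λ.trans hu0
      have hupos : 0 < D - e := hΛ.trans hu
      have hb0 := norm_ppShiftNumeratorDu_far_sub_le hβ hΛ hu m e
      have hb : ‖n₂ e‖ ≤ β / 4 * sech (β * (D - e) / 2) ^ 2 + Λ / (D - e) ^ 2 := by
        have h := norm_le_norm_add_norm_sub' (n₂ e) (((β / 4 * sech (β * (D - e) / 2) ^ 2 : ℝ) : ℂ))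
        rw [Complex.norm_real, Real.norm_eq_abs, abs_of_nonneg (by positivity : (0 : ℝ) ≤ β / 4 * sech (β * (D - e) / 2) ^ 2)] at h
        linarith
      have hsech : sech (β * (D - e) / 2) ^ 2 ≤ 4 * Real.exp (-(β * (D - e))) := sech_half_sq_le_four_exp_neg (by positivity)
      have hΛu : Λ / (D - e) ^ 2 * (D - e) ≤ Λ / u₀ := by
        rw [div_mul_eq_mul_div, show Λ * (D - e) / (D - e) ^ 2 = Λ / (D - e) by field_simp]
        exact div_le_div_of_nonneg_left hΛ.le (hΛ.trans hu₀Λ) hu0.le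
      calc ‖n₂ e‖ * |κ (e / D)| * (D - e) ≤ (β / 4 * sech (β * (D - e) / 2) ^ 2 + Λ / (D - e) ^ 2) * κ₀ * (D - e) :=
            mul_le_mul_of_nonneg_right (mul_le_mul hb (hκe e he) (abs_nonneg _) (by positivity)) hue
        _ = κ₀ * (β / 4 * sech (β * (D - e) / 2) ^ 2 * (D - e) + Λ / (D - e) ^ 2 * (D - e)) := by ring
        _ ≤ κ₀ * (β / 4 * (4 * Real.exp (-(β * (D - e)))) * (D - e) + Λ / u₀) := by gcongr
        _ = κ₀ * (β * (D - e) * Real.exp (-(β * (D - e))) + Λ / u₀) := by ring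
  have hi₂ : IntervalIntegrable (fun e => ‖n₂ e‖ * |κ (e / D)| * (D - e)) volume 0 D :=
    ((hn₂c.norm.mul hκDc.abs).mul (continuous_const.sub continuous_id)).intervalIntegrable _ _
  have hM₂ : ∫ e in (0 : ℝ)..D, ‖n₂ e‖ * |κ (e / D)| * (D - e) ≤ κ₀ * (1 / β + Λ / (1 - t₁)) := by
    have hgc : Continuous fun e : ℝ => κ₀ * (β * (D - e) * Real.exp (-(β * (D - e))) + Λ / u₀) :=
      continuous_const.mul (((continuous_const.mul (continuous_const.sub continuous_id)).mul
        (Real.continuous_exp.comp (continuous_const.mul (continuous_const.sub continuous_id)).neg)).add continuous_const)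
    have hmono : ∫ e in (0 : ℝ)..D, ‖n₂ e‖ * |κ (e / D)| * (D - e) ≤ ∫ e in (0 : ℝ)..D, κ₀ * (β * (D - e) * Real.exp (-(β * (D - e))) + Λ / u₀) :=
      intervalIntegral.integral_mono_on hDpos.le hi₂ (hgc.intervalIntegrable _ _) fun e he => hp₂ e he
    refine hmono.trans ?_
    rw [intervalIntegral.integral_const_mul]
    refine mul_le_mul_of_nonneg_left ?_ hκ₀
    have hfI : IntervalIntegrable (fun e : ℝ => β * (D - e) * Real.exp (-(β * (D - e)))) volume 0 D :=
      ((continuous_const.mul (continuous_const.sub continuous_id)).mul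
        (Real.continuous_exp.comp (continuous_const.mul (continuous_const.sub continuous_id)).neg)).intervalIntegrable _ _
    have hgI : IntervalIntegrable (fun _ : ℝ => Λ / u₀) volume 0 D := continuous_const.intervalIntegrable _ _
    rw [intervalIntegral.integral_add hfI hgI, intervalIntegral.integral_const, smul_eq_mul, sub_zero]
    have hsub : ∫ e in (0 : ℝ)..D, β * (D - e) * Real.exp (-(β * (D - e))) = ∫ u in (0 : ℝ)..D, β * u * Real.exp (-(β * u)) := by
      have h := intervalIntegral.integral_comp_sub_left (fun u : ℝ => β * u * Real.exp (-(β * u))) D (a := 0) (b := D)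
      rw [sub_self, sub_zero] at h
      exact h
    rw [hsub]
    have hexp := integral_mul_exp_neg_mul_le hβ le_rfl hDpos.le
    rw [zero_add, mul_zero, neg_zero, Real.exp_zero, mul_one] at hexp
    have hu₀D : D * (Λ / u₀) = Λ / (1 - t₁) := by rw [hu₀]; field_simp
    rw [hu₀D]
    linarith
  -- N₁: the value on the line
  have hpN : ∀ e ∈ Ι (0 : ℝ) D, ‖‖n e‖ * |κ (e / D)|‖ ≤ 4 * ‖w‖ / Λ * κ₀ := fun e he => by
    rw [uIoc_of_le hDpos.le] at he
    have heD : e ∈ Icc (0 : ℝ) D := ⟨he.1.le, he.2⟩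
    rw [Real.norm_eq_abs, abs_mul, abs_norm, abs_abs]
    have hv := norm_ppShiftNumerator_le hβ hΛ hm e (D - e)
    rw [transferDen_line] at hv
    exact mul_le_mul hv (hκe e heD) (abs_nonneg _) (by positivity)
  have hN₁ : ∫ e in (0 : ℝ)..D, ‖n e‖ * |κ (e / D)| ≤ 4 * ‖w‖ / Λ * κ₀ * D := by
    have h := intervalIntegral.norm_integral_le_of_norm_le_const hpN
    rw [Real.norm_eq_abs, sub_zero, abs_of_pos hDpos] at h
    have h' := (le_abs_self _).trans h
    linarith
  -- the abstract transfer lemma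
  have hmain := norm_integral_antidiagonal_flatness_transfer_le (n := n) (n₁ := n₁) (n₂ := n₂) (κ := κ) (κ' := κ') (Ω := Ω)
    (Ku := fun e => n₂ e * (κ (e / D) : ℂ) / D - n e * ((κ' (e / D) * (e / D) + κ (e / D) : ℝ) : ℂ) / (D : ℂ) ^ 2)
    (KuΩ := fun e => ((D : ℂ) - I * Ω)⁻¹ * (n₂ e * κ (e / D)) - n e * (((D : ℂ) - I * Ω)⁻¹ * (κ' (e / D) * (e / D)) / D + ((D : ℂ) - I * Ω)⁻¹ ^ 2 * κ (e / D)))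
    hDpos hnd hn₁c hn₂c hnc hκ hκ'c hbd (fun e _ => rfl) (fun e _ => rfl) hM₁ hM₂ hN₁
  refine hmain.trans (le_of_eq ?_)
  -- bookkeeping: `(M₁+M₂)/D² = κ₀(…)/D²`, `|Ω|/(D(D²+Ω²))·(4‖w‖κ₀D/Λ) = 4κ₀|Ω|/(Λ‖w‖)`
  have hwsq : D ^ 2 + Ω ^ 2 = ‖w‖ ^ 2 := hw2.symm
  rw [hwsq]
  field_simp
  ring

/-! ## §2 Short lines: every `D > 0` -/

/-- **Short lines.**  `|κ| ≤ κ₀`, `|κ′| ≤ κ₁` on `[0,1]`, `m ≠ 0`: for every `D > 0`, `‖∫_0^D ∂ᵤ𝒦_Ω(e,D−e) de‖ ≤ ((6B₁+13/2)κ₀ + 4κ₁)/Λ`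
(uniform gradient `(6B₁+5/2)/Λ`, value `‖N_Ω‖ ≤ 4|D−iΩ|/Λ`, `‖(D−iΩ)⁻¹‖ ≤ 1/D`). [cite: BenfattoGiulianiMastropietro2006, §2.4 (2.36)] -/
theorem shiftKernel_antidiagonal_flatness_short_le {β Λ : ℝ} (hβ : 0 < β) (hΛ : 0 < Λ) {B₁ : ℝ} (hB₁ : ∀ x, |deriv salmhoferCutoff x| ≤ B₁) {m : ℤ} (hm : m ≠ 0)
    {κ κ' : ℝ → ℝ} {κ₀ κ₁ D : ℝ} (hκb : ∀ t ∈ Icc 0 1, |κ t| ≤ κ₀) (hκ'b : ∀ t ∈ Icc 0 1, |κ' t| ≤ κ₁) (hD : 0 < D) :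
    ‖∫ e in (0 : ℝ)..D, (((D : ℂ) - I * (ppBose β m : ℝ))⁻¹ * (ppShiftNumeratorDu β Λ m e (D - e) * κ (e / D)) -
        ppShiftNumerator β Λ m e (D - e) *
          (((D : ℂ) - I * (ppBose β m : ℝ))⁻¹ * (κ' (e / D) * (e / D)) / D + ((D : ℂ) - I * (ppBose β m : ℝ))⁻¹ ^ 2 * κ (e / D)))‖ ≤
      ((6 * B₁ + 13 / 2) * κ₀ + 4 * κ₁) / Λ := by
  have hB0 := salmhoferB₁_nonneg hB₁
  have hκ₀ : 0 ≤ κ₀ := (abs_nonneg _).trans (hκb 0 (left_mem_Icc.2 zero_le_one))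
  have hκ₁ : 0 ≤ κ₁ := (abs_nonneg _).trans (hκ'b 0 (left_mem_Icc.2 zero_le_one))
  set Ω : ℝ := ppBose β m with hΩ
  set w : ℂ := (D : ℂ) - I * Ω with hw
  obtain ⟨hw1, -⟩ := norm_transfer_inv_le (Ω := Ω) hD
  obtain ⟨-, hwD⟩ := norm_transferDen_sq D Ω
  rw [abs_of_pos hD] at hwD
  have hwpos : 0 < ‖w‖ := hD.trans_le hwD
  have hwinv : ‖w⁻¹‖ = 1 / ‖w‖ := by rw [norm_inv, one_div]
  set S : ℝ := (6 * B₁ + 5 / 2) / Λ with hS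
  have hS0 : 0 ≤ S := by positivity
  have hpt : ∀ e ∈ Ι (0 : ℝ) D, ‖w⁻¹ * (ppShiftNumeratorDu β Λ m e (D - e) * κ (e / D)) -
      ppShiftNumerator β Λ m e (D - e) * (w⁻¹ * (κ' (e / D) * (e / D)) / D + w⁻¹ ^ 2 * κ (e / D))‖ ≤
        (S * κ₀ + 4 * κ₁ / Λ + 4 * κ₀ / Λ) / D := fun e he => by
    rw [uIoc_of_le hD.le] at he
    have ht : e / D ∈ Icc (0 : ℝ) 1 := ⟨div_nonneg he.1.le hD.le, (div_le_one hD).2 he.2⟩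
    have hN := norm_ppShiftNumerator_le hβ hΛ hm e (D - e)
    rw [transferDen_line] at hN
    have hDu := norm_ppShiftNumeratorDu_le_unif hβ hΛ hB₁ m e (D - e)
    have hk := hκb _ ht
    have hk' := hκ'b _ ht
    have hkC : ‖(κ (e / D) : ℂ)‖ ≤ κ₀ := by rw [Complex.norm_real, Real.norm_eq_abs]; exact hk
    have hk'C : ‖((κ' (e / D) : ℝ) : ℂ) * ((e / D : ℝ) : ℂ)‖ ≤ κ₁ := by
      rw [norm_mul, Complex.norm_real, Complex.norm_real, Real.norm_eq_abs, Real.norm_eq_abs, abs_of_nonneg ht.1]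
      calc |κ' (e / D)| * (e / D) ≤ κ₁ * 1 := mul_le_mul hk' ht.2 ht.1 hκ₁
        _ = κ₁ := mul_one _
    -- piece A: `‖w⁻¹·N_u·κ‖ ≤ (1/D)·S·κ₀`
    have hA : ‖w⁻¹ * (ppShiftNumeratorDu β Λ m e (D - e) * κ (e / D))‖ ≤ 1 / D * (S * κ₀) := by
      rw [norm_mul, norm_mul]
      exact mul_le_mul hw1 (mul_le_mul hDu hkC (norm_nonneg _) hS0) (by positivity) (by positivity)
    -- piece B: `‖N‖·‖w⁻¹‖ ≤ 4/Λ`, `‖N‖·‖w⁻¹‖² ≤ 4/(ΛD)`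
    have hNw : ‖ppShiftNumerator β Λ m e (D - e)‖ * ‖w⁻¹‖ ≤ 4 / Λ := by
      rw [hwinv]
      calc ‖ppShiftNumerator β Λ m e (D - e)‖ * (1 / ‖w‖) ≤ 4 * ‖w‖ / Λ * (1 / ‖w‖) := mul_le_mul_of_nonneg_right hN (by positivity)
        _ = 4 / Λ := by field_simp
    have hNw2 : ‖ppShiftNumerator β Λ m e (D - e)‖ * ‖w⁻¹‖ ^ 2 ≤ 4 / Λ * (1 / D) := by
      rw [pow_two, ← mul_assoc]
      exact mul_le_mul hNw hw1 (norm_nonneg _) (by positivity)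
    have hB : ‖ppShiftNumerator β Λ m e (D - e) * (w⁻¹ * (κ' (e / D) * (e / D)) / D + w⁻¹ ^ 2 * κ (e / D))‖ ≤
        4 / Λ * κ₁ * (1 / D) + 4 / Λ * (1 / D) * κ₀ := by
      rw [norm_mul]
      have h1 : ‖w⁻¹ * (κ' (e / D) * (e / D)) / D‖ ≤ ‖w⁻¹‖ * κ₁ * (1 / D) := by
        rw [norm_div, norm_mul, Complex.norm_real, Real.norm_eq_abs, abs_of_pos hD, div_eq_mul_one_div]
        have : ‖(κ' (e / D) : ℂ) * ((e / D : ℝ) : ℂ)‖ ≤ κ₁ := by exact_mod_cast hk'C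
        push_cast at this ⊢
        exact mul_le_mul_of_nonneg_right (mul_le_mul_of_nonneg_left this (norm_nonneg _)) (by positivity)
      have h2 : ‖w⁻¹ ^ 2 * (κ (e / D) : ℂ)‖ ≤ ‖w⁻¹‖ ^ 2 * κ₀ := by
        rw [norm_mul, norm_pow]; exact mul_le_mul_of_nonneg_left hkC (by positivity)
      calc ‖ppShiftNumerator β Λ m e (D - e)‖ * ‖w⁻¹ * (κ' (e / D) * (e / D)) / D + w⁻¹ ^ 2 * κ (e / D)‖
          ≤ ‖ppShiftNumerator β Λ m e (D - e)‖ * (‖w⁻¹‖ * κ₁ * (1 / D) + ‖w⁻¹‖ ^ 2 * κ₀) :=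
            mul_le_mul_of_nonneg_left ((norm_add_le _ _).trans (add_le_add h1 h2)) (norm_nonneg _)
        _ = ‖ppShiftNumerator β Λ m e (D - e)‖ * ‖w⁻¹‖ * κ₁ * (1 / D) + ‖ppShiftNumerator β Λ m e (D - e)‖ * ‖w⁻¹‖ ^ 2 * κ₀ := by ring
        _ ≤ 4 / Λ * κ₁ * (1 / D) + 4 / Λ * (1 / D) * κ₀ := by gcongr
    refine (norm_sub_le _ _).trans ((add_le_add hA hB).trans (le_of_eq ?_))
    field_simp
    ring
  have h := intervalIntegral.norm_integral_le_of_norm_le_const hpt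
  rw [sub_zero, abs_of_pos hD] at h
  refine h.trans (le_of_eq ?_)
  rw [hS]
  field_simp
  ring

/-! ## §3 The shape for every line -/

/-- **THE FLATNESS NUMBER OF THE TRANSFER KERNEL, FOR EVERY `D > 0`.**  Hypotheses of §1 with `|κ′| ≤ κ₁` on `[0,1]`: for every `D > 0`,
`‖∫_0^D ∂ᵤ𝒦_Ω(e,D−e) de‖ ≤ A₁^Ω·Λ/max(D,Λ)² + 4κ₀|Ω|/(Λ‖D−iΩ‖)`,
`A₁^Ω = ((6B₁+13/2)κ₀+4κ₁)·4/(1−t₁)² + κ₀(6B₁+7/2+2/(βΛ)+1/(1−t₁))`. [cite: FeldmanSalmhoferTrubowitz1998, §3] -/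
theorem shiftKernel_antidiagonal_flatness_shape {β Λ : ℝ} (hβ : 0 < β) (hΛ : 0 < Λ) {B₁ : ℝ} (hB₁ : ∀ x, |deriv salmhoferCutoff x| ≤ B₁) {m : ℤ} (hm : m ≠ 0)
    {κ κ' : ℝ → ℝ} {κ₀ κ₁ t₁ : ℝ} (hκ : ∀ t, HasDerivAt κ (κ' t) t) (hκ'c : Continuous κ') (hκb : ∀ t ∈ Icc 0 1, |κ t| ≤ κ₀)
    (hκ'b : ∀ t ∈ Icc 0 1, |κ' t| ≤ κ₁) (ht₀ : 0 ≤ t₁) (ht₁ : t₁ < 1) (hκs : ∀ t, t₁ ≤ t → κ t = 0) {D : ℝ} (hD : 0 < D) :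
    ‖∫ e in (0 : ℝ)..D, (((D : ℂ) - I * (ppBose β m : ℝ))⁻¹ * (ppShiftNumeratorDu β Λ m e (D - e) * κ (e / D)) -
        ppShiftNumerator β Λ m e (D - e) *
          (((D : ℂ) - I * (ppBose β m : ℝ))⁻¹ * (κ' (e / D) * (e / D)) / D + ((D : ℂ) - I * (ppBose β m : ℝ))⁻¹ ^ 2 * κ (e / D)))‖ ≤
      (((6 * B₁ + 13 / 2) * κ₀ + 4 * κ₁) * (4 / (1 - t₁) ^ 2) + κ₀ * (6 * B₁ + 7 / 2 + 2 / (β * Λ) + 1 / (1 - t₁))) * (Λ / max D Λ ^ 2) +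
        4 * κ₀ * |ppBose β m| / (Λ * ‖(D : ℂ) - I * (ppBose β m : ℝ)‖) := by
  have hB0 := salmhoferB₁_nonneg hB₁
  have hκ₀ : 0 ≤ κ₀ := (abs_nonneg _).trans (hκb 0 (left_mem_Icc.2 zero_le_one))
  have hκ₁ : 0 ≤ κ₁ := (abs_nonneg _).trans (hκ'b 0 (left_mem_Icc.2 zero_le_one))
  have h1t : 0 < 1 - t₁ := by linarith
  have hmax : 0 < max D Λ := lt_max_of_lt_right hΛ
  set C₁ : ℝ := (6 * B₁ + 13 / 2) * κ₀ + 4 * κ₁ with hC₁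
  set C₂ : ℝ := κ₀ * (6 * B₁ + 7 / 2 + 2 / (β * Λ) + 1 / (1 - t₁)) with hC₂
  set TΩ : ℝ := 4 * κ₀ * |ppBose β m| / (Λ * ‖(D : ℂ) - I * (ppBose β m : ℝ)‖) with hTΩ
  have hC₁0 : 0 ≤ C₁ := by positivity
  have hC₂0 : 0 ≤ C₂ := by positivity
  have hT0 : 0 ≤ TΩ := by positivity
  rcases le_or_gt D (2 * Λ / (1 - t₁)) with hshort | hlong
  · -- short line: `max(D,Λ) ≤ 2Λ/(1−t₁)`
    have hs := shiftKernel_antidiagonal_flatness_short_le hβ hΛ hB₁ hm (κ := κ) (κ' := κ') hκb hκ'b hD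
    have hm' : max D Λ ≤ 2 * Λ / (1 - t₁) := by
      refine max_le hshort ?_
      rw [le_div_iff₀ h1t]; nlinarith
    have hkey : C₁ / Λ ≤ C₁ * (4 / (1 - t₁) ^ 2) * (Λ / max D Λ ^ 2) := by
      have hm2 : max D Λ ^ 2 ≤ (2 * Λ / (1 - t₁)) ^ 2 := pow_le_pow_left₀ hmax.le hm' 2
      have h1 : 1 / Λ ≤ 4 / (1 - t₁) ^ 2 * (Λ / max D Λ ^ 2) := by
        rw [div_mul_div_comm, div_le_div_iff₀ hΛ (by positivity)]
        have : (1 - t₁) ^ 2 * max D Λ ^ 2 ≤ 4 * Λ ^ 2 := by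
          calc (1 - t₁) ^ 2 * max D Λ ^ 2 ≤ (1 - t₁) ^ 2 * (2 * Λ / (1 - t₁)) ^ 2 := mul_le_mul_of_nonneg_left hm2 (by positivity)
            _ = 4 * Λ ^ 2 := by field_simp; ring
        nlinarith
      calc C₁ / Λ = C₁ * (1 / Λ) := by ring
        _ ≤ C₁ * (4 / (1 - t₁) ^ 2 * (Λ / max D Λ ^ 2)) := mul_le_mul_of_nonneg_left h1 hC₁0
        _ = C₁ * (4 / (1 - t₁) ^ 2) * (Λ / max D Λ ^ 2) := by ring
    have hs' : ‖∫ e in (0 : ℝ)..D, (((D : ℂ) - I * (ppBose β m : ℝ))⁻¹ * (ppShiftNumeratorDu β Λ m e (D - e) * κ (e / D)) -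
        ppShiftNumerator β Λ m e (D - e) *
          (((D : ℂ) - I * (ppBose β m : ℝ))⁻¹ * (κ' (e / D) * (e / D)) / D + ((D : ℂ) - I * (ppBose β m : ℝ))⁻¹ ^ 2 * κ (e / D)))‖ ≤ C₁ / Λ := by
      rw [hC₁]; exact hs
    refine hs'.trans (hkey.trans ?_)
    have : 0 ≤ C₂ * (Λ / max D Λ ^ 2) := by positivity
    nlinarith
  · -- long line: `Λ < (1 − t₁)D`, `max(D,Λ) = D`
    have hfar : Λ < (1 - t₁) * D := by
      rw [div_lt_iff₀ h1t] at hlong; nlinarith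
    have hΛD : Λ < D := hfar.trans_le (by nlinarith)
    have hmD : max D Λ = D := max_eq_left hΛD.le
    have hl := shiftKernel_antidiagonal_flatness_le hβ hΛ hB₁ hm hκ hκ'c hκb hκ₀ ht₀ ht₁ hκs hfar
    rw [hmD]
    have hkey : κ₀ * ((6 * B₁ + 7 / 2) * Λ + 2 / β + Λ / (1 - t₁)) / D ^ 2 = C₂ * (Λ / D ^ 2) := by
      rw [hC₂]; field_simp
    rw [hkey] at hl
    refine hl.trans ?_
    have : 0 ≤ C₁ * (4 / (1 - t₁) ^ 2) * (Λ / D ^ 2) := by positivity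
    nlinarith

end Summit.HubbardSuperconductivity.HubbardSuperconductivity.Theorems.C4a

end
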